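import Literature.MathematicalPhysics.KineticTheory.ConfinedGeneratorStep
import Mathlib.MeasureTheory.Integral.IntervalIntegral.FundThmCalculus
import Mathlib.Probability.Kernel.Composition.IntegralCompProd
import Mathlib.Probability.Kernel.Composition.MeasureComp
import HarnessLib

/-!
# Dynkin's identity for the transition kernels of an SDE with a regular confined drift

Trunk T-KINETIC (Literature/MathematicalPhysics/KineticTheory). Model-free version of the Dynkin
part of `LangevinChainDynkin.lean`: for the transition kernels `sdeKernel Y v₁ v₂`
(`ConfinedDriftKernel.lean`) of `dz = Y(z) dt + v₁ dB¹ + v₂ dB²` with a `RegularConfinedDrift`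
structure on `Y` and noise directions in the noise subspace,

  `P_t f(z) - f(z) = ∫₀ᵗ P_s(Lf)(z) ds`,  `f ∈ C²_c`,  `L = sdeGenerator Y v₁ v₂`

(`RegularConfinedDrift.sdeKernel_dynkin`): `s ↦ P_s f(z)` is continuous (dominated convergence
along the continuous flow) with the uniform right derivative `P_s(Lf)(z)` (Chapman–Kolmogorov and
the one-step estimate `RegularConfinedDrift.generator_step`), and the fundamental theorem of
calculus for right derivatives concludes. Also: `sdeGenerator Y v₁ v₂ f` is continuous and
compactly supported for `f ∈ C²_c` and continuous `Y`.

## References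

* E. B. Dynkin, *Markov Processes* I (1965), Ch. I §2 (the identity `T_t f - f = ∫₀ᵗ T_s A f ds`).
  [folklore]
* L. Rey-Bellet, L. E. Thomas, Comm. Math. Phys. 225 (2002) 305–329, §2 eq. (13) and §3.1
  ("`T^t` the associated semigroup"). [cite: ReyBelletThomas2002, §2]
-/

noncomputable section

open MeasureTheory ProbabilityTheory Filter Topology Set Metric
open scoped NNReal ENNReal

namespace Literature.MathematicalPhysics.KineticTheory

open Literature.Probability.Process

variable {E : Type*} [NormedAddCommGroup E] [NormedSpace ℝ E]

/-! ### The generator of a `C²_c` function is continuous with compact support -/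

section GeneratorProps

variable {Y : E → E} (v₁ v₂ : E)

/-- `L f` is continuous for continuous `Y` and `f ∈ C²`. [folklore] -/
theorem continuous_sdeGenerator (hY : Continuous Y) {f : E → ℝ} (hf : ContDiff ℝ 2 f) :
    Continuous (sdeGenerator Y v₁ v₂ f) := by
  have h1 : Continuous (fderiv ℝ f) := hf.continuous_fderiv (by norm_num)
  have h2 : Continuous (fderiv ℝ (fderiv ℝ f)) :=
    (hf.fderiv_right (m := 1) (by norm_num)).continuous_fderiv one_ne_zero
  unfold sdeGenerator
  exact (h1.clm_apply hY).add (continuous_const.mul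
    (((h2.clm_apply continuous_const).clm_apply continuous_const).add
      ((h2.clm_apply continuous_const).clm_apply continuous_const)))

/-- `L f` vanishes off the topological support of `f`. [folklore] -/
theorem sdeGenerator_eq_zero_of_notMem_tsupport {f : E → ℝ} {y : E} (hy : y ∉ tsupport f) :
    sdeGenerator Y v₁ v₂ f y = 0 := by
  have h1 : fderiv ℝ f y = 0 := Function.notMem_support.1 fun hmem => hy (support_fderiv_subset ℝ hmem)
  have h2 : fderiv ℝ (fderiv ℝ f) y = 0 := Function.notMem_support.1 fun hmem =>
    hy (tsupport_fderiv_subset ℝ (support_fderiv_subset ℝ hmem))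
  simp [sdeGenerator, h1, h2]

/-- `L f` has compact support if `f` has. [folklore] -/
theorem hasCompactSupport_sdeGenerator {f : E → ℝ} (hfc : HasCompactSupport f) :
    HasCompactSupport (sdeGenerator Y v₁ v₂ f) :=
  hfc.mono' fun _ hy => by_contra fun h => hy (sdeGenerator_eq_zero_of_notMem_tsupport v₁ v₂ h)

/-- `L f` is bounded for continuous `Y` and `f ∈ C²_c`. [folklore] -/
theorem exists_bound_sdeGenerator (hY : Continuous Y) {f : E → ℝ} (hf : ContDiff ℝ 2 f)
    (hfc : HasCompactSupport f) : ∃ C, ∀ y, ‖sdeGenerator Y v₁ v₂ f y‖ ≤ C :=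
  (continuous_sdeGenerator v₁ v₂ hY hf).bounded_above_of_compact_support
    (hasCompactSupport_sdeGenerator v₁ v₂ hfc)

end GeneratorProps

/-! ### Dynkin's identity -/

namespace RegularConfinedDrift

variable [FiniteDimensional ℝ E] [CompleteSpace E] [MeasurableSpace E] [BorelSpace E]
  [SecondCountableTopology E] {Y : E → E} (D : RegularConfinedDrift Y) {v₁ v₂ : E}
  (hv₁ : v₁ ∈ D.noise) (hv₂ : v₂ ∈ D.noise)
include D hv₁ hv₂

/-- **Dynkin's identity for the transition kernels `sdeKernel Y v₁ v₂`**: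
`P_t f(z) - f(z) = ∫₀ᵗ P_s(Lf)(z) ds` for `f ∈ C²_c`, `L = sdeGenerator Y v₁ v₂`. Proof:
`φ(s) = P_s f(z)` is continuous (dominated convergence along the continuous flow) and has the RIGHT
derivative `P_s(Lf)(z)` at every `s ≥ 0` by the Chapman–Kolmogorov equation (`sdeKernel_add`) and
the uniform one-step estimate `generator_step`; the fundamental theorem of calculus for right
derivatives concludes. [folklore] -/
theorem sdeKernel_dynkin {f : E → ℝ} (hf : ContDiff ℝ 2 f) (hf' : HasCompactSupport f)
    (t : ℝ≥0) (z : E) :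
    ∫ y, f y ∂(sdeKernel Y v₁ v₂ t z) - f z =
      ∫ s in (0 : ℝ)..(t : ℝ), ∫ y, sdeGenerator Y v₁ v₂ f y ∂(sdeKernel Y v₁ v₂ s.toNNReal z) := by
  set κ := sdeKernel Y v₁ v₂ with hκ
  haveI : ∀ s, IsMarkovKernel (κ s) := fun s => D.isMarkovKernel_sdeKernel hv₁ hv₂ s
  set Lf := sdeGenerator Y v₁ v₂ f with hLf
  have hYc : Continuous Y := D.contDiff_drift.continuous
  have hLc : Continuous Lf := continuous_sdeGenerator v₁ v₂ hYc hf
  obtain ⟨CL, hCL⟩ := exists_bound_sdeGenerator v₁ v₂ hYc hf hf'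
  obtain ⟨Cf, hCf⟩ : ∃ C, ∀ x, ‖f x‖ ≤ C := hf.continuous.bounded_above_of_compact_support hf'
  set φ : ℝ → ℝ := fun s => ∫ y, f y ∂(κ s.toNNReal z) with hφ
  set ψ : ℝ → ℝ := fun s => ∫ y, Lf y ∂(κ s.toNNReal z) with hψ
  -- representation through the flow
  have hφ' : φ = fun s => ∫ w, f (sdeSolMap Y v₁ v₂ (s.toNNReal : ℝ) z (pairPath w)) ∂wienerPair := by
    funext s
    exact D.integral_sdeKernel hv₁ hv₂ _ z hf.continuous.aestronglyMeasurable
  have hψ' : ψ = fun s => ∫ w, Lf (sdeSolMap Y v₁ v₂ (s.toNNReal : ℝ) z (pairPath w)) ∂wienerPair := by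
    funext s
    exact D.integral_sdeKernel hv₁ hv₂ _ z hLc.aestronglyMeasurable
  -- continuity (dominated convergence along the continuous flow)
  have hflow_cont : ∀ w, Continuous fun s : ℝ => sdeSolMap Y v₁ v₂ (s.toNNReal : ℝ) z (pairPath w) :=
    fun w => (D.continuous_sdeSolMap hv₁ hv₂ z (pairPath w)).comp
      (continuous_subtype_val.comp continuous_real_toNNReal)
  have hflow_meas : ∀ s : ℝ, Measurable fun w => sdeSolMap Y v₁ v₂ (s.toNNReal : ℝ) z (pairPath w) :=
    fun s => D.measurable_sdeSolMap_pairPath_right hv₁ hv₂ _ z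
  have hcontφ : Continuous φ := by
    rw [hφ']
    exact continuous_of_dominated (fun s => (hf.continuous.measurable.comp (hflow_meas s)).aestronglyMeasurable)
      (fun s => Eventually.of_forall fun w => hCf _) (integrable_const Cf)
      (Eventually.of_forall fun w => hf.continuous.comp (hflow_cont w))
  have hcontψ : Continuous ψ := by
    rw [hψ']
    exact continuous_of_dominated (fun s => (hLc.measurable.comp (hflow_meas s)).aestronglyMeasurable)
      (fun s => Eventually.of_forall fun w => hCL _) (integrable_const CL)
      (Eventually.of_forall fun w => hLc.comp (hflow_cont w))
  -- integrability against the kernels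
  have hf_int : ∀ μ : Measure E, IsFiniteMeasure μ → Integrable f μ := fun μ _ =>
    (integrable_const Cf).mono' hf.continuous.aestronglyMeasurable (Eventually.of_forall hCf)
  have hLf_int : ∀ μ : Measure E, IsFiniteMeasure μ → Integrable Lf μ := fun μ _ =>
    (integrable_const CL).mono' hLc.aestronglyMeasurable (Eventually.of_forall hCL)
  have hPf_meas : ∀ r : ℝ≥0, StronglyMeasurable fun y => ∫ y', f y' ∂(κ r y) := fun r =>
    hf.continuous.stronglyMeasurable.integral_kernel (κ := κ r)
  have hPf_bound : ∀ (r : ℝ≥0) y, ‖∫ y', f y' ∂(κ r y)‖ ≤ Cf := fun r y => by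
    calc ‖∫ y', f y' ∂(κ r y)‖ ≤ Cf * (κ r y).real univ := norm_integral_le_of_norm_le_const (Eventually.of_forall hCf)
      _ = Cf := by simp [probReal_univ]
  -- the right derivative, uniformly in `s ≥ 0`
  have hderiv : ∀ s : ℝ, 0 ≤ s → HasDerivWithinAt φ (ψ s) (Ioi s) s := by
    intro s hs
    rw [hasDerivWithinAt_iff_tendsto, Metric.tendsto_nhdsWithin_nhds]
    intro ε hε
    obtain ⟨h₀, hh₀, hstep⟩ := D.generator_step hv₁ hv₂ hf hf' (half_pos hε)
    refine ⟨h₀, hh₀, fun x hx hxs => ?_⟩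
    have hxpos : 0 < x - s := sub_pos.2 hx
    set hh : ℝ≥0 := ⟨x - s, hxpos.le⟩ with hhh
    have hhco : ((hh : ℝ≥0) : ℝ) = x - s := rfl
    have hxle : x - s ≤ h₀ := by
      rw [dist_eq_norm, Real.norm_eq_abs, abs_of_pos hxpos] at hxs
      exact hxs.le
    have hxnn : x.toNNReal = s.toNNReal + hh := by
      apply NNReal.eq
      rw [NNReal.coe_add, Real.coe_toNNReal _ (hs.trans hx.le), Real.coe_toNNReal _ hs, hhco]
      ring
    -- Chapman–Kolmogorov: `φ x = ∫ P_hh f d(κ_s z)`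
    have e1 : φ x = ∫ y, (∫ y', f y' ∂(κ hh y)) ∂(κ s.toNNReal z) := by
      simp only [hφ]
      rw [hxnn, hκ, D.sdeKernel_add hv₁ hv₂, ← hκ]
      exact Kernel.integral_comp (hf_int _ inferInstance)
    have hPhf_int : Integrable (fun y => ∫ y', f y' ∂(κ hh y)) (κ s.toNNReal z) :=
      (integrable_const Cf).mono' (hPf_meas hh).aestronglyMeasurable (Eventually.of_forall (hPf_bound hh))
    have key : |φ x - φ s - (x - s) * ψ s| ≤ ε / 2 * (x - s) := by
      have i1 : Integrable (fun y => (∫ y', f y' ∂(κ hh y)) - f y) (κ s.toNNReal z) :=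
        hPhf_int.sub (hf_int _ inferInstance)
      have e2 : φ x - φ s - (x - s) * ψ s =
          ∫ y, ((∫ y', f y' ∂(κ hh y)) - f y - (hh : ℝ) * Lf y) ∂(κ s.toNNReal z) := by
        rw [integral_sub i1 ((hLf_int _ inferInstance).const_mul _), integral_sub hPhf_int (hf_int _ inferInstance),
          integral_const_mul, hhco, e1]
      rw [e2]
      calc |∫ y, ((∫ y', f y' ∂(κ hh y)) - f y - (hh : ℝ) * Lf y) ∂(κ s.toNNReal z)|
          ≤ ∫ y, |(∫ y', f y' ∂(κ hh y)) - f y - (hh : ℝ) * Lf y| ∂(κ s.toNNReal z) :=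
            abs_integral_le_integral_abs
        _ ≤ ∫ y, ε / 2 * (x - s) ∂(κ s.toNNReal z) := by
            refine integral_mono_of_nonneg (Eventually.of_forall fun y => abs_nonneg _) (integrable_const _)
              (Eventually.of_forall fun y => ?_)
            dsimp only
            have := hstep hh (by rw [hhco]; exact hxpos) (by rw [hhco]; exact hxle) y
            rw [← D.integral_sdeKernel hv₁ hv₂ hh y hf.continuous.aestronglyMeasurable] at this
            exact this
        _ = ε / 2 * (x - s) := by simp [probReal_univ]
    rw [dist_eq_norm, Real.norm_eq_abs, sub_zero, abs_mul, abs_inv, Real.norm_eq_abs, Real.norm_eq_abs,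
      abs_abs, abs_abs, abs_of_pos hxpos, smul_eq_mul]
    rw [inv_mul_lt_iff₀ hxpos]
    calc |φ x - φ s - (x - s) * ψ s| ≤ ε / 2 * (x - s) := key
      _ < ε * (x - s) := by nlinarith
      _ = (x - s) * ε := mul_comm _ _
  -- the fundamental theorem of calculus for right derivatives
  have hFTC := intervalIntegral.integral_eq_sub_of_hasDeriv_right_of_le t.coe_nonneg hcontφ.continuousOn
    (fun x hx => hderiv x hx.1.le) (hcontψ.intervalIntegrable _ _)
  have hφ0 : φ 0 = f z := by
    simp only [hφ, Real.toNNReal_zero, hκ]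
    rw [D.sdeKernel_zero hv₁ hv₂, Kernel.id_apply, integral_dirac]
  have hφt : φ t = ∫ y, f y ∂(κ t z) := by simp only [hφ, Real.toNNReal_coe]
  rw [← hφt, ← hφ0, ← hFTC]

end RegularConfinedDrift

end Literature.MathematicalPhysics.KineticTheory
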